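import Mathlib
import Literature.Dynamics.Contraction.ComplexConeContraction
import Summits.CriticalPhenomena.CardyFormulaZ2.Theorems.CardyComplexConeComplexConeContractionCone
import Summits.CriticalPhenomena.CardyFormulaZ2.Theorems.CardyComplexConeComplexConeContractionRowPairs

/-!
# Images of `ℂⁿ₊` under a Dubois matrix: interior and uniform ratio bound on `E(Ax, Ay)`

Helper file for item stmt-CriticalPhenomena-8789 (`ComplexConeContraction`, route CardyComplexCone
of `CardyFormulaZ2`). For a rectangular matrix `A : ℂⁿ → ℂᵐ` satisfying Dubois' aperture condition
with parameter `θ ∈ (0,1)` we prove: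

* `mulVec_apply_ne_zero`, `mulVec_ratio_mem_duboisE`, `mulVec_mem_rughConeInt` — for
  `x ∈ ℂⁿ₊ ∖ {0}` the image `u = A x` has nonzero coordinates, its ratios `u_l / u_k` lie in the
  row-pair set `E_kl = E_{Int}(λ_k, λ_l)`, and `A x ∈ Int ℂᵐ₊` (Dubois 2009, Prop. 3.3 `⇐`, first
  assertion of Thm. 3.6);
* `norm_bounds_of_re_nonpos` — the normalised disc: `Re((ζ s − t) conj(ζ − 1)) ≤ 0`, `Re s > 0`,
  forces `(|conj s + t| − |s − t|)/(2 Re s) ≤ |ζ| ≤ (|conj s + t| + |s − t|)/(2 Re s)` (Lemma 3.2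
  for the vectors `(1, s)`, `(1, t)`);
* `duboisE_mulVec_ratio_bound` — the **uniform ratio bound** replacing the diameter estimate of
  Dubois' Theorem 3.6: for `x, y ∈ ℂⁿ₊ ∖ {0}` and `z, w ∈ E_{Int ℂᵐ₊}(Ax, Ay)` one has
  `|z| ≤ (1 + K)⁴ |w|` with `K = ((1+θ)/(1−θ))³`, i.e. `δ_{ℂᵐ₊}(Ax, Ay) ≤ 4 log(1 + K)` uniformly
  (this is (3.23)–(3.25) of the paper with the hyperbolic estimates replaced by `rowPair_chain`).
  The second printed hypothesis `|a_kp a_lq| ≤ σ² |a_kq a_lp|` is not needed.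

Reference: L. Dubois, *Projective metrics and contraction principles for complex cones*, J. London
Math. Soc. 79 (2009), §3.
-/

open scoped ComplexConjugate
open Metric Set

namespace Summit.CriticalPhenomena.CardyFormulaZ2.Theorems.ComplexConeContraction

open Literature.Dynamics.Contraction

/-! ### The normalised disc -/

/-- `|conj s + t|² − |s − t|² = 4 Re(s) Re(t)`. -/
theorem normSq_conj_add_sub_normSq_sub (s t : ℂ) :
    ‖conj s + t‖ ^ 2 - ‖s - t‖ ^ 2 = 4 * s.re * t.re := by
  rw [← Complex.normSq_eq_norm_sq, ← Complex.normSq_eq_norm_sq]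
  simp only [Complex.normSq_apply, Complex.add_re, Complex.add_im, Complex.sub_re, Complex.sub_im,
    Complex.conj_re, Complex.conj_im]
  ring

/-- `|conj s + t| ≤ 2 Re s + |t − s|` for `Re s ≥ 0`
(write `conj s + t = (s + conj s) + (t − s)`). -/
theorem norm_conj_add_le {s t : ℂ} (hs : 0 ≤ s.re) : ‖conj s + t‖ ≤ 2 * s.re + ‖t - s‖ := by
  have h1 : conj s + t = (s + conj s) + (t - s) := by ring
  have h2 : ‖s + conj s‖ = 2 * s.re := by
    rw [Complex.add_conj, Complex.norm_real, Real.norm_eq_abs, abs_of_nonneg (by linarith)]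
  calc ‖conj s + t‖ = ‖(s + conj s) + (t - s)‖ := by rw [h1]
    _ ≤ ‖s + conj s‖ + ‖t - s‖ := norm_add_le _ _
    _ = 2 * s.re + ‖t - s‖ := by rw [h2]

/-- **The normalised disc** (Dubois' Lemma 3.2 for the vectors `(1, s)` and `(1, t)`): if `Re s > 0`
and `Re((ζ s − t) conj(ζ − 1)) ≤ 0` then `ζ` lies in the closed disc of centre
`(conj s + t)/(2 Re s)` and radius `|s − t|/(2 Re s)`, whence the two bounds on `|ζ|`. -/
theorem norm_bounds_of_re_nonpos {s t ζ : ℂ} (hs : 0 < s.re)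
    (h : ((ζ * s - t) * conj (ζ - 1)).re ≤ 0) :
    ‖ζ‖ ≤ (‖conj s + t‖ + ‖s - t‖) / (2 * s.re) ∧
      (‖conj s + t‖ - ‖s - t‖) / (2 * s.re) ≤ ‖ζ‖ := by
  have hα : 0 < ((![1, s] : Fin 2 → ℂ) 0 * conj ((![1, s] : Fin 2 → ℂ) 1)).re := by
    simpa using hs
  have h' : ((ζ * (![1, s] : Fin 2 → ℂ) 1 - (![1, t] : Fin 2 → ℂ) 1) *
      conj (ζ * (![1, s] : Fin 2 → ℂ) 0 - (![1, t] : Fin 2 → ℂ) 0)).re ≤ 0 := by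
    simpa using h
  have hmem := (re_mul_conj_nonpos_iff_mem_closedBall ![1, s] ![1, t] 0 1 hα ζ).1 h'
  have hc : duboisCenter ![1, s] ![1, t] 0 1 = (conj s + t) / ((2 * s.re : ℝ) : ℂ) := by
    simp [duboisCenter]
  have hr : duboisRadius ![1, s] ![1, t] 0 1 = ‖s - t‖ / (2 * s.re) := by
    simp [duboisRadius]
  rw [hc, hr, mem_closedBall, dist_eq_norm] at hmem
  have hnc : ‖(conj s + t) / ((2 * s.re : ℝ) : ℂ)‖ = ‖conj s + t‖ / (2 * s.re) := by
    rw [norm_div, Complex.norm_real, Real.norm_eq_abs, abs_of_pos (by linarith)]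
  have h1 := norm_sub_norm_le ζ ((conj s + t) / ((2 * s.re : ℝ) : ℂ))
  have h2 := norm_sub_norm_le ((conj s + t) / ((2 * s.re : ℝ) : ℂ)) ζ
  rw [norm_sub_rev] at h2
  rw [hnc] at h1 h2
  constructor
  · rw [add_div]; linarith
  · rw [sub_div]; linarith

section Images

variable {θ : ℝ} {m n : ℕ} {A : Matrix (Fin m) (Fin n) ℂ}

/-- Coordinates of `A x` as bilinear pairings `Σ_i x_i a_ki`. -/
theorem mulVec_apply_eq_sum (A : Matrix (Fin m) (Fin n) ℂ) (x : Fin n → ℂ) (k : Fin m) :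
    A.mulVec x k = ∑ i, x i * A k i := by
  simp only [Matrix.mulVec, dotProduct]
  exact Finset.sum_congr rfl fun i _ => mul_comm _ _

/-- For `x ∈ ℂⁿ₊ ∖ {0}` every coordinate of `A x` is nonzero (rows of `A` are in `Int ℂⁿ₊`, pairing
lemma). -/
theorem mulVec_apply_ne_zero (hθ : 0 < θ)
    (hA : ∀ k l p q, θ⁻¹ * ‖A k p * A l q - A k q * A l p‖ <
      (conj (A k p) * A l q + conj (A k q) * A l p).re)
    {x : Fin n → ℂ} (hx : x ∈ rughCone n) (hx0 : x ≠ 0) (k : Fin m) : A.mulVec x k ≠ 0 := by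
  rw [mulVec_apply_eq_sum]
  exact sum_mul_ne_zero hx hx0 (row_mem_rughConeInt hθ hA k)

/-- For `x ∈ ℂⁿ₊ ∖ {0}` and `u = A x`, the ratio `u_l / u_k` lies in the row-pair set
`E_{Int ℂⁿ₊}(λ_k, λ_l)` (the vector `(u_l/u_k) λ_k − λ_l` is annihilated by `x`, hence not in
`Int ℂⁿ₊`; Dubois 2009, proof of Prop. 3.3). -/
theorem mulVec_ratio_mem_duboisE (hθ : 0 < θ)
    (hA : ∀ k l p q, θ⁻¹ * ‖A k p * A l q - A k q * A l p‖ <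
      (conj (A k p) * A l q + conj (A k q) * A l p).re)
    {x : Fin n → ℂ} (hx : x ∈ rughCone n) (hx0 : x ≠ 0) (k l : Fin m) :
    A.mulVec x l / A.mulVec x k ∈ duboisE (rughConeInt n) (A k) (A l) := by
  intro hmem
  have hk := mulVec_apply_ne_zero hθ hA hx hx0 k
  apply sum_mul_ne_zero hx hx0 hmem
  have e1 : ∑ i, x i * ((A.mulVec x l / A.mulVec x k) • A k - A l) i =
      (A.mulVec x l / A.mulVec x k) * (∑ i, x i * A k i) - ∑ i, x i * A l i := by
    simp only [Pi.sub_apply, Pi.smul_apply, smul_eq_mul, mul_sub, Finset.sum_sub_distrib,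
      Finset.mul_sum]
    congr 1
    exact Finset.sum_congr rfl fun i _ => by ring
  rw [e1, ← mulVec_apply_eq_sum, ← mulVec_apply_eq_sum, div_mul_cancel₀ _ hk, sub_self]

/-- **Dubois 2009, Prop. 3.3 (`⇐`) / Thm. 3.6 (first assertion), rectangular version**: a matrix
satisfying Dubois' condition maps `ℂⁿ₊ ∖ {0}` into `Int ℂᵐ₊`. -/
theorem mulVec_mem_rughConeInt (hθ : 0 < θ) (hθ1 : θ < 1)
    (hA : ∀ k l p q, θ⁻¹ * ‖A k p * A l q - A k q * A l p‖ <
      (conj (A k p) * A l q + conj (A k q) * A l p).re)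
    {x : Fin n → ℂ} (hx : x ∈ rughCone n) (hx0 : x ≠ 0) : A.mulVec x ∈ rughConeInt m := by
  intro k l
  have hmem := mulVec_ratio_mem_duboisE hθ hA hx hx0 k l
  have hs := (rowPair_chain hθ hθ1 hA k l hmem hmem).1
  have hk := mulVec_apply_ne_zero hθ hA hx hx0 k
  have hk' : conj (A.mulVec x k) ≠ 0 := (map_ne_zero _).2 hk
  have e : A.mulVec x k * conj (A.mulVec x l) =
      (Complex.normSq (A.mulVec x k) : ℂ) * conj (A.mulVec x l / A.mulVec x k) := by
    rw [map_div₀, ← Complex.mul_conj]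
    field_simp
  rw [e, Complex.re_ofReal_mul]
  exact mul_pos (Complex.normSq_pos.2 hk) (by rwa [Complex.conj_re])

/-- Normalisation of the membership condition `Re((z u_k − v_k) conj(z u_l − v_l)) ≤ 0`: with
`s = u_l/u_k`, `t = v_l/v_k`, `ζ = z u_k / v_k` it reads `Re((ζ s − t) conj(ζ − 1)) ≤ 0`. -/
theorem re_nonpos_normalise {uk ul vk vl z : ℂ} (huk : uk ≠ 0) (hvk : vk ≠ 0)
    (h : ((z * uk - vk) * conj (z * ul - vl)).re ≤ 0) :
    (((z * uk / vk) * (ul / uk) - vl / vk) * conj (z * uk / vk - 1)).re ≤ 0 := by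
  have e1 : z * uk - vk = vk * (z * uk / vk - 1) := by field_simp
  have e2 : z * ul - vl = vk * ((z * uk / vk) * (ul / uk) - vl / vk) := by field_simp
  rw [e1, e2, map_mul] at h
  have e3 : vk * (z * uk / vk - 1) * (conj vk * conj ((z * uk / vk) * (ul / uk) - vl / vk)) =
      (Complex.normSq vk : ℂ) *
        ((z * uk / vk - 1) * conj ((z * uk / vk) * (ul / uk) - vl / vk)) := by
    rw [← Complex.mul_conj]; ring
  rw [e3, Complex.re_ofReal_mul] at h
  have h' : ((z * uk / vk - 1) * conj ((z * uk / vk) * (ul / uk) - vl / vk)).re ≤ 0 := by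
    rcases mul_nonpos_iff.1 h with ⟨_, h2⟩ | ⟨h1, _⟩
    · exact h2
    · exact absurd h1 (not_le.2 (Complex.normSq_pos.2 hvk))
  have hcomm : ∀ a b : ℂ, (a * conj b).re = (b * conj a).re := fun a b => by
    simp only [Complex.mul_re, Complex.conj_re, Complex.conj_im]; ring
  rw [hcomm]
  exact h'

/-- Upper half of the ratio bound: for `z ∈ E(Ax, Ay)` there is a row `k` with
`|z| |(Ax)_k| ≤ (1 + K) |(Ay)_k|`. -/
theorem norm_mul_le_of_mem_duboisE_mulVec (hθ : 0 < θ) (hθ1 : θ < 1)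
    (hA : ∀ k l p q, θ⁻¹ * ‖A k p * A l q - A k q * A l p‖ <
      (conj (A k p) * A l q + conj (A k q) * A l p).re)
    {x y : Fin n → ℂ} (hx : x ∈ rughCone n) (hx0 : x ≠ 0) (hy : y ∈ rughCone n) (hy0 : y ≠ 0)
    {z : ℂ} (hz : z ∈ duboisE (rughConeInt m) (A.mulVec x) (A.mulVec y)) :
    ∃ k, ‖z‖ * ‖A.mulVec x k‖ ≤ (1 + ((1 + θ) / (1 - θ)) ^ 3) * ‖A.mulVec y k‖ := by
  set K := ((1 + θ) / (1 - θ)) ^ 3 with hK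
  set u := A.mulVec x with hu
  set v := A.mulVec y with hv
  have hz' : ¬ ∀ k l, 0 < ((z • u - v) k * conj ((z • u - v) l)).re := hz
  push Not at hz'
  obtain ⟨k, l, hkl⟩ := hz'
  simp only [Pi.sub_apply, Pi.smul_apply, smul_eq_mul] at hkl
  have huk : u k ≠ 0 := mulVec_apply_ne_zero hθ hA hx hx0 k
  have hvk : v k ≠ 0 := mulVec_apply_ne_zero hθ hA hy hy0 k
  have hnorm := re_nonpos_normalise huk hvk hkl
  set s := u l / u k with hs_def
  set t := v l / v k with ht_def
  set ζ := z * u k / v k with hζ_def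
  have hsE : s ∈ duboisE (rughConeInt n) (A k) (A l) := mulVec_ratio_mem_duboisE hθ hA hx hx0 k l
  have htE : t ∈ duboisE (rughConeInt n) (A k) (A l) := mulVec_ratio_mem_duboisE hθ hA hy hy0 k l
  obtain ⟨hs_re, hts, -⟩ := rowPair_chain hθ hθ1 hA k l hsE htE
  have hup := (norm_bounds_of_re_nonpos hs_re hnorm).1
  have hK0 : 0 ≤ K := by rw [hK]; exact pow_nonneg (div_nonneg (by linarith) (by linarith)) 3
  -- `|ζ| ≤ (2 Re s + 2 |t - s|)/(2 Re s) ≤ 1 + K`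
  have hζ : ‖ζ‖ ≤ 1 + K := by
    have h1 : ‖conj s + t‖ + ‖s - t‖ ≤ 2 * s.re + 2 * (K * s.re) := by
      have h2 := norm_conj_add_le hs_re.le (t := t)
      rw [norm_sub_rev] at h2
      have hts' : ‖s - t‖ ≤ K * s.re := by rw [hK, norm_sub_rev]; exact hts
      linarith
    calc ‖ζ‖ ≤ (‖conj s + t‖ + ‖s - t‖) / (2 * s.re) := hup
      _ ≤ (2 * s.re + 2 * (K * s.re)) / (2 * s.re) := div_le_div_of_nonneg_right h1 (by linarith)
      _ = 1 + K := by field_simp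
  refine ⟨k, ?_⟩
  have e : ‖z‖ * ‖u k‖ = ‖ζ‖ * ‖v k‖ := by
    rw [hζ_def, norm_div, norm_mul, div_mul_cancel₀ _ (norm_ne_zero_iff.2 hvk)]
  rw [e]
  exact mul_le_mul_of_nonneg_right hζ (norm_nonneg _)

/-- Lower half of the ratio bound: for `w ∈ E(Ax, Ay)` there is a row `p` with
`|(Ay)_p| ≤ (1 + K) K |w| |(Ax)_p|`. -/
theorem norm_le_of_mem_duboisE_mulVec (hθ : 0 < θ) (hθ1 : θ < 1)
    (hA : ∀ k l p q, θ⁻¹ * ‖A k p * A l q - A k q * A l p‖ <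
      (conj (A k p) * A l q + conj (A k q) * A l p).re)
    {x y : Fin n → ℂ} (hx : x ∈ rughCone n) (hx0 : x ≠ 0) (hy : y ∈ rughCone n) (hy0 : y ≠ 0)
    {w : ℂ} (hw : w ∈ duboisE (rughConeInt m) (A.mulVec x) (A.mulVec y)) :
    ∃ p, ‖A.mulVec y p‖ ≤
      (1 + ((1 + θ) / (1 - θ)) ^ 3) * ((1 + θ) / (1 - θ)) ^ 3 * (‖w‖ * ‖A.mulVec x p‖) := by
  set K := ((1 + θ) / (1 - θ)) ^ 3 with hK
  set u := A.mulVec x with hu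
  set v := A.mulVec y with hv
  have hw' : ¬ ∀ k l, 0 < ((w • u - v) k * conj ((w • u - v) l)).re := hw
  push Not at hw'
  obtain ⟨p, q, hpq⟩ := hw'
  simp only [Pi.sub_apply, Pi.smul_apply, smul_eq_mul] at hpq
  have hup : u p ≠ 0 := mulVec_apply_ne_zero hθ hA hx hx0 p
  have hvp : v p ≠ 0 := mulVec_apply_ne_zero hθ hA hy hy0 p
  have hnorm := re_nonpos_normalise hup hvp hpq
  set s := u q / u p with hs_def
  set t := v q / v p with ht_def
  set ζ := w * u p / v p with hζ_def
  have hsE : s ∈ duboisE (rughConeInt n) (A p) (A q) := mulVec_ratio_mem_duboisE hθ hA hx hx0 p q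
  have htE : t ∈ duboisE (rughConeInt n) (A p) (A q) := mulVec_ratio_mem_duboisE hθ hA hy hy0 p q
  obtain ⟨hs_re, hts, -⟩ := rowPair_chain hθ hθ1 hA p q hsE htE
  obtain ⟨ht_re, -, hst⟩ := rowPair_chain hθ hθ1 hA p q htE hsE
  have hlow := (norm_bounds_of_re_nonpos hs_re hnorm).2
  have hK0 : 0 ≤ K := by rw [hK]; exact pow_nonneg (div_nonneg (by linarith) (by linarith)) 3
  -- `N = |conj s + t|`, `D = |s - t|`: `N² - D² = 4 Re s Re t`, `N + D ≤ 2 (1+K) Re s`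
  set N := ‖conj s + t‖ with hN
  set D := ‖s - t‖ with hD
  have hND : (N - D) * (N + D) = 4 * s.re * t.re := by
    have := normSq_conj_add_sub_normSq_sub s t
    rw [← hN, ← hD] at this
    linarith [this, sq N, sq D, show (N - D) * (N + D) = N ^ 2 - D ^ 2 by ring]
  have hNDle : N + D ≤ 2 * (1 + K) * s.re := by
    have h1 := norm_conj_add_le hs_re.le (t := t)
    have hts' : D ≤ K * s.re := by rw [hD, norm_sub_rev]; exact hts
    rw [← hN] at h1
    have : ‖t - s‖ = D := by rw [hD, norm_sub_rev]
    rw [this] at h1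
    linarith
  have hNDpos : 0 < N + D := by
    have : 0 < (N - D) * (N + D) := by rw [hND]; positivity
    rcases lt_trichotomy (N + D) 0 with hlt | heq | hgt
    · linarith [norm_nonneg (conj s + t), norm_nonneg (s - t)]
    · rw [heq, mul_zero] at this; exact absurd this (lt_irrefl 0)
    · exact hgt
  have hNmD : 2 * t.re ≤ (1 + K) * (N - D) := by
    -- `4 Re s Re t = (N-D)(N+D) ≤ (N-D) 2(1+K) Re s`
    have hNmD0 : 0 ≤ N - D := by
      by_contra hneg
      have : (N - D) * (N + D) < 0 := mul_neg_of_neg_of_pos (not_le.1 hneg) hNDpos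
      rw [hND] at this
      have : 0 < 4 * s.re * t.re := by positivity
      linarith
    have h1 : (N - D) * (N + D) ≤ (N - D) * (2 * (1 + K) * s.re) :=
      mul_le_mul_of_nonneg_left hNDle hNmD0
    rw [hND] at h1
    nlinarith
  -- `|ζ| ≥ (N-D)/(2 Re s) ≥ Re t/((1+K) Re s) ≥ 1/((1+K)K)`
  have hζ1 : N - D ≤ 2 * s.re * ‖ζ‖ := by
    have := hlow
    rwa [div_le_iff₀ (by linarith), mul_comm] at this
  have hmain : 1 ≤ (1 + K) * K * ‖ζ‖ := by
    -- from `2 Re t ≤ (1+K)(N-D) ≤ (1+K) 2 Re s |ζ|` and `Re s ≤ K Re t`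
    have h2 : 2 * t.re ≤ (1 + K) * (2 * s.re * ‖ζ‖) :=
      hNmD.trans (mul_le_mul_of_nonneg_left hζ1 (by linarith))
    have h3 : s.re ≤ K * t.re := hst
    by_contra hlt
    have hlt' : (1 + K) * K * ‖ζ‖ < 1 := not_le.1 hlt
    have h4 : s.re * ((1 + K) * K * ‖ζ‖) < s.re * 1 := mul_lt_mul_of_pos_left hlt' hs_re
    nlinarith [mul_le_mul_of_nonneg_left h2 hK0]
  refine ⟨p, ?_⟩
  have e : ‖w‖ * ‖u p‖ = ‖ζ‖ * ‖v p‖ := by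
    rw [hζ_def, norm_div, norm_mul, div_mul_cancel₀ _ (norm_ne_zero_iff.2 hvp)]
  calc ‖v p‖ = 1 * ‖v p‖ := (one_mul _).symm
    _ ≤ ((1 + K) * K * ‖ζ‖) * ‖v p‖ := mul_le_mul_of_nonneg_right hmain (norm_nonneg _)
    _ = (1 + K) * K * (‖ζ‖ * ‖v p‖) := by ring
    _ = (1 + K) * K * (‖w‖ * ‖u p‖) := by rw [e]

/-- Cross comparison of two rows: `|(Ax)_p| |(Ay)_k| ≤ (1 + K) |(Ax)_k| |(Ay)_p|` (the factor
`e^{Δ₁}` of Dubois' (3.25)). -/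
theorem norm_mul_norm_le_cross (hθ : 0 < θ) (hθ1 : θ < 1)
    (hA : ∀ k l p q, θ⁻¹ * ‖A k p * A l q - A k q * A l p‖ <
      (conj (A k p) * A l q + conj (A k q) * A l p).re)
    {x y : Fin n → ℂ} (hx : x ∈ rughCone n) (hx0 : x ≠ 0) (hy : y ∈ rughCone n) (hy0 : y ≠ 0)
    (k p : Fin m) :
    ‖A.mulVec x p‖ * ‖A.mulVec y k‖ ≤
      (1 + ((1 + θ) / (1 - θ)) ^ 3) * (‖A.mulVec x k‖ * ‖A.mulVec y p‖) := by
  set K := ((1 + θ) / (1 - θ)) ^ 3 with hK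
  set u := A.mulVec x with hu
  set v := A.mulVec y with hv
  have huk : u k ≠ 0 := mulVec_apply_ne_zero hθ hA hx hx0 k
  have hvk : v k ≠ 0 := mulVec_apply_ne_zero hθ hA hy hy0 k
  have hsE : u p / u k ∈ duboisE (rughConeInt n) (A k) (A p) :=
    mulVec_ratio_mem_duboisE hθ hA hx hx0 k p
  have htE : v p / v k ∈ duboisE (rughConeInt n) (A k) (A p) :=
    mulVec_ratio_mem_duboisE hθ hA hy hy0 k p
  obtain ⟨ht_re, hst, -⟩ := rowPair_chain hθ hθ1 hA k p htE hsE
  have hK0 : 0 ≤ K := by rw [hK]; exact pow_nonneg (div_nonneg (by linarith) (by linarith)) 3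
  -- `|s'| ≤ |t'| + |s' - t'| ≤ |t'| + K Re t' ≤ (1+K)|t'|`
  have h1 : ‖u p / u k‖ ≤ (1 + K) * ‖v p / v k‖ := by
    have h2 := norm_le_norm_add_norm_sub' (u p / u k) (v p / v k)
    have h3 : (v p / v k).re ≤ ‖v p / v k‖ := Complex.re_le_norm _
    nlinarith
  rw [norm_div, norm_div, div_le_iff₀ (norm_pos_iff.2 huk), mul_comm (1 + K), mul_assoc,
    ] at h1
  rw [div_mul_eq_mul_div, le_div_iff₀ (norm_pos_iff.2 hvk)] at h1
  linarith

/-- **Uniform ratio bound on `E(Ax, Ay)`** (the diameter estimate of Dubois 2009, Thm. 3.6, in ratio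
form and for rectangular matrices): for `x, y ∈ ℂⁿ₊ ∖ {0}` and `z, w ∈ E_{Int ℂᵐ₊}(Ax, Ay)`,
`|z| ≤ (1 + K)⁴ |w|` with `K = ((1+θ)/(1−θ))³`. -/
theorem duboisE_mulVec_ratio_bound (hθ : 0 < θ) (hθ1 : θ < 1)
    (hA : ∀ k l p q, θ⁻¹ * ‖A k p * A l q - A k q * A l p‖ <
      (conj (A k p) * A l q + conj (A k q) * A l p).re)
    {x y : Fin n → ℂ} (hx : x ∈ rughCone n) (hx0 : x ≠ 0) (hy : y ∈ rughCone n) (hy0 : y ≠ 0)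
    {z w : ℂ} (hz : z ∈ duboisE (rughConeInt m) (A.mulVec x) (A.mulVec y))
    (hw : w ∈ duboisE (rughConeInt m) (A.mulVec x) (A.mulVec y)) :
    ‖z‖ ≤ (1 + ((1 + θ) / (1 - θ)) ^ 3) ^ 4 * ‖w‖ := by
  set K := ((1 + θ) / (1 - θ)) ^ 3 with hK
  have hK0 : 0 ≤ K := by rw [hK]; exact pow_nonneg (div_nonneg (by linarith) (by linarith)) 3
  obtain ⟨k, hk⟩ := norm_mul_le_of_mem_duboisE_mulVec hθ hθ1 hA hx hx0 hy hy0 hz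
  obtain ⟨p, hp⟩ := norm_le_of_mem_duboisE_mulVec hθ hθ1 hA hx hx0 hy hy0 hw
  have hc := norm_mul_norm_le_cross hθ hθ1 hA hx hx0 hy hy0 k p
  rw [← hK] at hk hp hc
  have huk : 0 < ‖A.mulVec x k‖ := norm_pos_iff.2 (mulVec_apply_ne_zero hθ hA hx hx0 k)
  have hup : 0 < ‖A.mulVec x p‖ := norm_pos_iff.2 (mulVec_apply_ne_zero hθ hA hx hx0 p)
  have hvk : 0 < ‖A.mulVec y k‖ := norm_pos_iff.2 (mulVec_apply_ne_zero hθ hA hy hy0 k)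
  have hvp : 0 < ‖A.mulVec y p‖ := norm_pos_iff.2 (mulVec_apply_ne_zero hθ hA hy hy0 p)
  -- chain: |z| |u_k| |u_p| ≤ (1+K)|v_k||u_p| ≤ (1+K)² |u_k||v_p| ≤ (1+K)³ K |w| |u_p| |u_k|
  have h1 : ‖z‖ * ‖A.mulVec x k‖ * ‖A.mulVec x p‖ ≤
      (1 + K) ^ 3 * K * ‖w‖ * ‖A.mulVec x p‖ * ‖A.mulVec x k‖ := by
    calc ‖z‖ * ‖A.mulVec x k‖ * ‖A.mulVec x p‖
        ≤ (1 + K) * ‖A.mulVec y k‖ * ‖A.mulVec x p‖ := mul_le_mul_of_nonneg_right hk hup.le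
      _ = (1 + K) * (‖A.mulVec x p‖ * ‖A.mulVec y k‖) := by ring
      _ ≤ (1 + K) * ((1 + K) * (‖A.mulVec x k‖ * ‖A.mulVec y p‖)) :=
          mul_le_mul_of_nonneg_left hc (by linarith)
      _ = (1 + K) ^ 2 * ‖A.mulVec x k‖ * ‖A.mulVec y p‖ := by ring
      _ ≤ (1 + K) ^ 2 * ‖A.mulVec x k‖ * ((1 + K) * K * (‖w‖ * ‖A.mulVec x p‖)) :=
          mul_le_mul_of_nonneg_left hp (by positivity)
      _ = (1 + K) ^ 3 * K * ‖w‖ * ‖A.mulVec x p‖ * ‖A.mulVec x k‖ := by ring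
  have h2 : ‖z‖ ≤ (1 + K) ^ 3 * K * ‖w‖ := by
    have h1' : ‖z‖ * (‖A.mulVec x k‖ * ‖A.mulVec x p‖) ≤
        ((1 + K) ^ 3 * K * ‖w‖) * (‖A.mulVec x k‖ * ‖A.mulVec x p‖) := by
      calc ‖z‖ * (‖A.mulVec x k‖ * ‖A.mulVec x p‖)
          = ‖z‖ * ‖A.mulVec x k‖ * ‖A.mulVec x p‖ := by ring
        _ ≤ _ := h1
        _ = ((1 + K) ^ 3 * K * ‖w‖) * (‖A.mulVec x k‖ * ‖A.mulVec x p‖) := by ring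
    exact le_of_mul_le_mul_right h1' (mul_pos huk hup)
  calc ‖z‖ ≤ (1 + K) ^ 3 * K * ‖w‖ := h2
    _ ≤ (1 + K) ^ 3 * (1 + K) * ‖w‖ := by
        apply mul_le_mul_of_nonneg_right _ (norm_nonneg _)
        exact mul_le_mul_of_nonneg_left (by linarith) (by positivity)
    _ = (1 + K) ^ 4 * ‖w‖ := by ring

end Images

end Summit.CriticalPhenomena.CardyFormulaZ2.Theorems.ComplexConeContraction
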